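import Summits.BirchSwinnertonDyer.Rank1Residual.Supersingular.KuriharaTwistIdentityPrelim
import HarnessLib

/-!
# The leading-term lemma for a distribution system with eigenvalue `2` (KERNEL PROOF of the
# bins-to-`δ̃` identity behind `KuriharaTwistSchema*.lean`, abstract half)

Cell `b2b-bsdres`, team n1011, seat p09 GEN 3, OWNERS row T-TW3 (rider of ROUTE-1 §19.6 R1-18), FILE 4
(preliminaries: `KuriharaTwistIdentityPrelim.lean`).
Namespace `Summit.BirchSwinnertonDyer.Rank1Residual.Supersingular.KuriharaTwist.Identity`.

HONEST FRAMING (run/shared/lean/b2b/bsd-rank1-residual/, verbatim in every file): the goal of the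
cell is to DELETE the COMBINATION-SHAPED residual classes of the Birch–Swinnerton-Dyer formula for
ALL analytic-rank `≤ 1` elliptic curves over `ℚ` — "full BSD formula for every rank `≤ 1` curve in
class `C`" assembled STRICTLY from published theorems — so that the rank-`≤ 1` remainder becomes
exactly the CONSTRUCTION-SHAPED classes, which are TYPED (missing-input `Prop`s), NOT attempted.
This is not "finishing BSD".  Team n1011 is a RESEARCH ROUTE; this file is a TOOL THEOREM of
elementary algebra (no named fact, no elliptic curve, nothing booked; marks unchanged).

## What this file proves

The identity re-decided in `KuriharaTwistSchemaOdd.lean` (module docstring) — the structure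
congruences `e_t ≡ 0 (t < ν)` and the recomputation `e_ν ≡ c_∞·δ̃_n` of the twist-record recheck —
follows from ONE structural property of the plus modular symbol: the Hecke distribution relation at
each Kolyvagin prime `ℓ` with `a_ℓ ≡ 2 (mod q)`.  This file isolates that structure and proves the
identity's heart abstractly, by an ideal-adic induction (no monomial bookkeeping):

* `DistSystem ι G B` — a DISTRIBUTION SYSTEM with eigenvalue `2` on a finite product of finite abelian
  groups `Π_i G_i` (for the symbol: `G_ℓ = (ℤ/ℓ)ˣ`, `x_U(a) = [a/n_U]⁺ mod q`, `g_ℓ` = the image of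
  `ℓ` in the other factors): level functions `x U` depending only on the `U`-coordinates and
  `Σ_{b ∈ G_i} x_U(b, c) = 2·x_{U∖i}(c) − x_{U∖i}(g_i c) − x_{U∖i}(g_i⁻¹ c)`.
* `D_mem_pow_succ` (KEY LEMMA) — for characters `χ_ℓ : G_ℓ → Bˣ` with `χ_ℓ ≡ 1 (mod J)` and
  `D(U, W) := Σ_{a} x_U(a)·Π_{ℓ∈W}(χ_ℓ(a_ℓ) − 1)`: `D(U, W) ∈ J^{|U|+1}` whenever `W ⊊ U`.  Proof:
  remove a prime `i ∈ U∖W` with the distribution relation; translating the weight by `g_i^{±1}`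
  multiplies each factor `χ_ℓ − 1 = z_ℓ` into `u_ℓ^{±1}z_ℓ + (u_ℓ^{±1} − 1)`; expanding
  (`Finset.prod_add`) gives `D(U,W) = 2D(U′,W) − Σ_{V⊆W} (α⁺_V + α⁻_V)·D(U′,V)`; for `V ⊊ W` the
  coefficient has a factor `u_ℓ − 1 ∈ J` and `D(U′,V) ∈ J^{|U|}` by induction; for `V = W` the
  coefficient is `2 − Πu − Πu⁻¹ = −(Πu)⁻¹(Πu − 1)² ∈ J²` and `D(U′,W) ∈ J^{|U|−1}`.
* `Theta_sub_mem` (LEADING-TERM LEMMA) — if moreover `χ_ℓ(b) ≡ 1 + L_ℓ(b)·y (mod J²)` with `y ∈ J`,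
  then `Θ_U := Σ_a x_U(a)·Π_ℓ χ_ℓ(a_ℓ) ≡ y^{|U|}·Σ_a x_U(a)·Π_ℓ L_ℓ(a_ℓ) (mod J^{|U|+1})`
  (`Θ_U = Σ_{W⊆U} D(U,W)`; the top term by `prod_sub_pow_mul_prod_mem`).

The concrete instance `B = (ℤ/q)[Y]/(Y^p)`, `χ_ℓ(b) = (1+Y)^{log_ℓ b}`, `y = Y`, whose `Y`-adic
coefficients of `Θ_U` ARE the binomial moments `e_t` of the sum-bins, is the sibling
`KuriharaTwistIdentityBins.lean` (FILE 5).  References: Mazur–Tate 1987 / Darmon 1992 (order of vanishing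
of `θ`-elements; the classical source of the `(a_ℓ − σ_ℓ − σ_ℓ⁻¹)` factorisation), C.-H. Kim
arXiv:2203.12159 §1.4 [Kim2022StructureSelmer]; seat NOTES.md (n1011-p09 GEN 3, T-TW3b plan).
-/

open Finset

namespace Summit.BirchSwinnertonDyer.Rank1Residual.Supersingular.KuriharaTwist.Identity
section Main

variable {ι : Type*} [Fintype ι] [DecidableEq ι]
variable {G : ι → Type*} [∀ i, CommGroup (G i)] [∀ i, Fintype (G i)] [∀ i, DecidableEq (G i)]
variable {B : Type*} [CommRing B]

/-- A DISTRIBUTION SYSTEM with eigenvalue `2` on the product group `Π_i G_i`: level functions `x U`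
(one per finite set of indices `U`, depending only on the `U`-coordinates), translation elements `g i`
(the image of the prime `ℓ_i` in the other components), and the Hecke distribution relation with
`a_{ℓ_i} = 2`: summing `x U` over the `i`-th coordinate gives `2·x_{U∖i} − x_{U∖i}(g_i ·) − x_{U∖i}(g_i⁻¹ ·)`. [folklore] -/
structure DistSystem (ι : Type*) [DecidableEq ι] (G : ι → Type*) [∀ i, CommGroup (G i)]
    [∀ i, Fintype (G i)] [Fintype ι] [∀ i, DecidableEq (G i)] (B : Type*) [CommRing B] where
  /-- the level-`U` function -/
  x : Finset ι → (Π i, G i) → B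
  /-- the image of the `i`-th prime in the other components -/
  g : ι → Π i, G i
  /-- `x U` depends only on the `U`-coordinates -/
  inv : ∀ U (a b : Π i, G i), (∀ i ∈ U, a i = b i) → x U a = x U b
  /-- the distribution relation with eigenvalue `2` -/
  dist : ∀ U i, i ∈ U → ∀ c ∈ slice (U.erase i),
    ∑ b : G i, x U (Function.update c i b) =
      2 * x (U.erase i) c - x (U.erase i) (g i * c) - x (U.erase i) ((g i)⁻¹ * c)

variable (S : DistSystem ι G B) (χ : Π i, G i →* Bˣ)

/-- `D U W = Σ_{a ∈ slice U} x_U(a) · Π_{ℓ ∈ W} (χ_ℓ(a_ℓ) − 1)`. [folklore] -/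
def D (U W : Finset ι) : B :=
  ∑ a ∈ slice U, S.x U a * ∏ l ∈ W, ((χ l (a l) : Bˣ) - 1 : B)

variable (J : Ideal B) (hχ : ∀ i (b : G i), ((χ i b : Bˣ) : B) - 1 ∈ J)

include hχ in
/-- Trivial bound: `D U W ∈ J ^ |W|`. [folklore] -/
theorem D_mem_pow_card (U W : Finset ι) : D S χ U W ∈ J ^ W.card := by
  unfold D
  refine sum_mem fun a _ => Ideal.mul_mem_left _ _ ?_
  exact prod_mem_pow_card J W _ fun l _ => hχ l (a l)

omit [Fintype ι] in
/-- The expansion `Π_{ℓ∈W} (u_ℓ·(1 + z_ℓ) − 1) = Σ_{V ⊆ W} (Π_V u_ℓ)·(Π_{W∖V} (u_ℓ − 1))·Π_V z_ℓ`. [folklore] -/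
theorem prod_mul_add_sub_one (W : Finset ι) (u z : ι → B) :
    ∏ l ∈ W, (u l * (1 + z l) - 1) =
      ∑ V ∈ W.powerset, ((∏ l ∈ V, u l) * ∏ l ∈ W \ V, (u l - 1)) * ∏ l ∈ V, z l := by
  have : ∀ l ∈ W, u l * (1 + z l) - 1 = u l * z l + (u l - 1) := fun l _ => by ring
  rw [Finset.prod_congr rfl this, Finset.prod_add]
  refine Finset.sum_congr rfl fun V _ => ?_
  rw [Finset.prod_mul_distrib]; ring

include hχ in
/-- KEY LEMMA (ideal-adic leading-term lemma): for `W ⊊ U`, `D U W ∈ J ^ (|U| + 1)`. [folklore] -/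
theorem D_mem_pow_succ : ∀ (n : ℕ) (U W : Finset ι), U.card = n → W ⊂ U → D S χ U W ∈ J ^ (n + 1) := by
  intro n
  induction n using Nat.strong_induction_on with
  | _ n ih =>
  intro U W hU hWU
  obtain ⟨i, hiU, hiW⟩ := Finset.exists_of_ssubset hWU
  set U' := U.erase i with hU'
  have hcard : U'.card = n - 1 := by rw [hU', Finset.card_erase_of_mem hiU, hU]
  have hn : 1 ≤ n := by rw [← hU]; exact Finset.card_pos.2 ⟨i, hiU⟩
  have hWU' : W ⊆ U' := fun l hl => Finset.mem_erase.2 ⟨fun h => hiW (h ▸ hl), hWU.1 hl⟩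
  -- abbreviations
  set x' := S.x U' with hx'
  set w : (Π i, G i) → B := fun a => ∏ l ∈ W, (((χ l (a l) : Bˣ) : B) - 1) with hw
  set gπ := proj U' (S.g i) with hgπ
  have hgπ_mem : gπ ∈ slice U' := proj_mem_slice U' (S.g i)
  have hgπ_inv_mem : gπ⁻¹ ∈ slice U' := by
    rw [mem_slice] at hgπ_mem ⊢; intro j hj; simp [hgπ_mem j hj]
  -- step 1: split the sum at coordinate i and apply the distribution relation
  have step1 : D S χ U W = ∑ c ∈ slice U', (2 * x' c - x' (S.g i * c) - x' ((S.g i)⁻¹ * c)) * w c := by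
    unfold D
    rw [sum_slice_eq_sum_erase_update hiU]
    refine Finset.sum_congr rfl fun c hc => ?_
    have hwc : ∀ b : G i,
        (∏ l ∈ W, (((χ l ((Function.update c i b) l) : Bˣ) : B) - 1)) = w c := by
      intro b
      simp only [hw]
      refine Finset.prod_congr rfl fun l hl => ?_
      have : l ≠ i := fun h => hiW (h ▸ hl)
      rw [Function.update_of_ne this]
    have : ∀ b ∈ (Finset.univ : Finset (G i)),
        S.x U (Function.update c i b) * (∏ l ∈ W, (((χ l ((Function.update c i b) l) : Bˣ) : B) - 1)) =
          S.x U (Function.update c i b) * w c := fun b _ => by rw [hwc b]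
    rw [Finset.sum_congr rfl this, ← Finset.sum_mul, S.dist U i hiU c hc]
  -- step 2: move the translations from x' to w
  have hinvg : ∀ c : Π i, G i, x' (S.g i * c) = x' (gπ * c) := by
    intro c; apply S.inv; intro j hj; simp [hgπ, proj_apply_of_mem hj]
  have hinvg' : ∀ c : Π i, G i, x' ((S.g i)⁻¹ * c) = x' (gπ⁻¹ * c) := by
    intro c; apply S.inv; intro j hj; simp [hgπ, proj_apply_of_mem hj]
  have step2a : ∑ c ∈ slice U', x' (S.g i * c) * w c = ∑ c ∈ slice U', x' c * w (gπ⁻¹ * c) := by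
    calc ∑ c ∈ slice U', x' (S.g i * c) * w c
        = ∑ c ∈ slice U', (fun c => x' c * w (gπ⁻¹ * c)) (gπ * c) :=
          Finset.sum_congr rfl fun c _ => by
            show x' (S.g i * c) * w c = x' (gπ * c) * w (gπ⁻¹ * (gπ * c))
            rw [hinvg c, ← mul_assoc, inv_mul_cancel, one_mul]
      _ = ∑ c ∈ slice U', x' c * w (gπ⁻¹ * c) :=
          sum_slice_mul_left U' hgπ_mem (fun c => x' c * w (gπ⁻¹ * c))
  have step2b : ∑ c ∈ slice U', x' ((S.g i)⁻¹ * c) * w c = ∑ c ∈ slice U', x' c * w (gπ * c) := by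
    calc ∑ c ∈ slice U', x' ((S.g i)⁻¹ * c) * w c
        = ∑ c ∈ slice U', (fun c => x' c * w (gπ * c)) (gπ⁻¹ * c) :=
          Finset.sum_congr rfl fun c _ => by
            show x' ((S.g i)⁻¹ * c) * w c = x' (gπ⁻¹ * c) * w (gπ * (gπ⁻¹ * c))
            rw [hinvg' c, ← mul_assoc, mul_inv_cancel, one_mul]
      _ = ∑ c ∈ slice U', x' c * w (gπ * c) :=
          sum_slice_mul_left U' hgπ_inv_mem (fun c => x' c * w (gπ * c))
  -- step 3: expand w(gπ^{±1} c) over subsets V ⊆ W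
  set u : ι → B := fun l => ((χ l (S.g i l) : Bˣ) : B) with hu
  set uinv : ι → B := fun l => (((χ l (S.g i l))⁻¹ : Bˣ) : B) with huinv
  set z : (Π i, G i) → ι → B := fun c l => ((χ l (c l) : Bˣ) : B) - 1 with hz
  have hwg : ∀ c : Π i, G i, w (gπ * c) =
      ∑ V ∈ W.powerset, ((∏ l ∈ V, u l) * ∏ l ∈ W \ V, (u l - 1)) * ∏ l ∈ V, z c l := by
    intro c
    rw [← prod_mul_add_sub_one]
    simp only [hw]
    refine Finset.prod_congr rfl fun l hl => ?_
    have hl' : l ∈ U' := hWU' hl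
    simp only [Pi.mul_apply, hgπ, proj_apply_of_mem hl', map_mul, Units.val_mul, hu, hz]
    ring
  have hwg' : ∀ c : Π i, G i, w (gπ⁻¹ * c) =
      ∑ V ∈ W.powerset, ((∏ l ∈ V, uinv l) * ∏ l ∈ W \ V, (uinv l - 1)) * ∏ l ∈ V, z c l := by
    intro c
    rw [← prod_mul_add_sub_one]
    simp only [hw]
    refine Finset.prod_congr rfl fun l hl => ?_
    have hl' : l ∈ U' := hWU' hl
    simp only [Pi.mul_apply, Pi.inv_apply, hgπ, proj_apply_of_mem hl', map_mul, map_inv, Units.val_mul,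
      huinv, hz]
    ring
  -- D U' V in terms of z
  have hDV : ∀ V : Finset ι, D S χ U' V = ∑ c ∈ slice U', x' c * ∏ l ∈ V, z c l := by
    intro V; rfl
  -- assemble: D U W = 2 D' W − Σ_V α⁻_V D' V − Σ_V α⁺_V D' V
  have stepA : ∑ c ∈ slice U', 2 * (x' c * w c) = 2 * D S χ U' W := by
    rw [← Finset.mul_sum]; rfl
  have stepB : ∑ c ∈ slice U', x' (S.g i * c) * w c =
      ∑ V ∈ W.powerset, ((∏ l ∈ V, uinv l) * ∏ l ∈ W \ V, (uinv l - 1)) * D S χ U' V := by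
    rw [step2a]
    simp only [hwg', Finset.mul_sum]
    rw [Finset.sum_comm]
    refine Finset.sum_congr rfl fun V _ => ?_
    rw [hDV, Finset.mul_sum]
    refine Finset.sum_congr rfl fun c _ => ?_
    ring
  have stepC : ∑ c ∈ slice U', x' ((S.g i)⁻¹ * c) * w c =
      ∑ V ∈ W.powerset, ((∏ l ∈ V, u l) * ∏ l ∈ W \ V, (u l - 1)) * D S χ U' V := by
    rw [step2b]
    simp only [hwg, Finset.mul_sum]
    rw [Finset.sum_comm]
    refine Finset.sum_congr rfl fun V _ => ?_
    rw [hDV, Finset.mul_sum]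
    refine Finset.sum_congr rfl fun c _ => ?_
    ring
  have step3 : D S χ U W = 2 * D S χ U' W
      - ∑ V ∈ W.powerset, ((∏ l ∈ V, uinv l) * ∏ l ∈ W \ V, (uinv l - 1)) * D S χ U' V
      - ∑ V ∈ W.powerset, ((∏ l ∈ V, u l) * ∏ l ∈ W \ V, (u l - 1)) * D S χ U' V := by
    rw [step1]
    have : ∀ c ∈ slice U', (2 * x' c - x' (S.g i * c) - x' ((S.g i)⁻¹ * c)) * w c =
        2 * (x' c * w c) - x' (S.g i * c) * w c - x' ((S.g i)⁻¹ * c) * w c := fun c _ => by ring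
    rw [Finset.sum_congr rfl this, Finset.sum_sub_distrib, Finset.sum_sub_distrib, stepA, stepB, stepC]
  -- membership
  rw [step3]
  -- split off V = W in both sums
  have hWp : W ∈ W.powerset := Finset.mem_powerset_self W
  rw [← Finset.add_sum_erase _ _ hWp, ← Finset.add_sum_erase _ _ hWp]
  simp only [Finset.sdiff_self, Finset.prod_empty, mul_one]
  -- the V = W terms combine to (2 − Πu⁻¹ − Πu)·D' W
  have hmain : 2 * D S χ U' W - (∏ l ∈ W, uinv l) * D S χ U' W - (∏ l ∈ W, u l) * D S χ U' W
      ∈ J ^ (n + 1) := by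
    have e : 2 * D S χ U' W - (∏ l ∈ W, uinv l) * D S χ U' W - (∏ l ∈ W, u l) * D S χ U' W =
        -(((∏ l ∈ W, u l) + (∏ l ∈ W, uinv l) - 2) * D S χ U' W) := by ring
    rw [e]
    refine Submodule.neg_mem _ ?_
    -- Πu is a unit t with t − 1 ∈ J; Π uinv = t⁻¹
    set t : Bˣ := ∏ l ∈ W, χ l (S.g i l) with ht
    have htu : (∏ l ∈ W, u l) = (t : B) := by simp [hu, ht, Units.coe_prod]
    have htuinv : (∏ l ∈ W, uinv l) = ((t⁻¹ : Bˣ) : B) := by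
      simp only [huinv, ht]
      rw [← Finset.prod_inv_distrib, Units.coe_prod]
    rw [htu, htuinv]
    have h2 : (t : B) + ((t⁻¹ : Bˣ) : B) - 2 ∈ J ^ 2 := by
      refine add_inv_sub_two_mem_sq J t ?_
      rw [← htu]
      exact prod_sub_one_mem J W u fun l _ => hχ l _
    -- D' W ∈ J^{n-1}
    have hD' : D S χ U' W ∈ J ^ (n - 1) := by
      by_cases hW : W = U'
      · rw [hW, ← hcard]; exact D_mem_pow_card S χ J hχ U' U'
      · have hss : W ⊂ U' := Finset.ssubset_iff_subset_ne.2 ⟨hWU', hW⟩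
        have := ih (n - 1) (by omega) U' W hcard hss
        exact Ideal.pow_le_pow_right (by omega) this
    have := Ideal.mul_mem_mul h2 hD'
    rw [← pow_add] at this
    exact Ideal.pow_le_pow_right (by omega) this
  -- the V ⊊ W terms: coefficient ∈ J (a factor u_l − 1 with l ∈ W \ V ≠ ∅), D' V ∈ J^n by IH
  have hrest : ∀ (v : ι → B), (∀ l, v l - 1 ∈ J) →
      ∑ V ∈ W.powerset.erase W, ((∏ l ∈ V, v l) * ∏ l ∈ W \ V, (v l - 1)) * D S χ U' V ∈ J ^ (n + 1) := by
    intro v hv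
    refine sum_mem fun V hV => ?_
    obtain ⟨hVW, hVp⟩ := Finset.mem_erase.1 hV
    have hVsub : V ⊆ W := Finset.mem_powerset.1 hVp
    have hVss : V ⊂ W := Finset.ssubset_iff_subset_ne.2 ⟨hVsub, hVW⟩
    have hVU' : V ⊂ U' := Finset.ssubset_of_ssubset_of_subset hVss hWU'
    have hDV' : D S χ U' V ∈ J ^ n := by
      have := ih (n - 1) (by omega) U' V hcard hVU'
      rwa [show n - 1 + 1 = n by omega] at this
    obtain ⟨l, hlW, hlV⟩ := Finset.exists_of_ssubset hVss
    have hcoef : (∏ l ∈ V, v l) * ∏ l ∈ W \ V, (v l - 1) ∈ J := by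
      refine Ideal.mul_mem_left _ _ ?_
      have hl : l ∈ W \ V := Finset.mem_sdiff.2 ⟨hlW, hlV⟩
      rw [← Finset.mul_prod_erase _ _ hl]
      exact Ideal.mul_mem_right _ _ (hv l)
    have := Ideal.mul_mem_mul hcoef hDV'
    rwa [← pow_succ'] at this
  have hu1 : ∀ l, u l - 1 ∈ J := fun l => hχ l _
  have huinv1 : ∀ l, uinv l - 1 ∈ J := by
    intro l
    -- uinv l − 1 = −uinv l · (u l − 1)
    have e : uinv l - 1 = -(uinv l * (u l - 1)) := by
      have : uinv l * u l = 1 := by simp [hu, huinv]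
      linear_combination this
    rw [e]; exact Submodule.neg_mem _ (Ideal.mul_mem_left _ _ (hu1 l))
  have H1 := hrest uinv huinv1
  have H2 := hrest u hu1
  -- combine
  have e : 2 * D S χ U' W
      - ((∏ l ∈ W, uinv l) * D S χ U' W
          + ∑ V ∈ W.powerset.erase W, ((∏ l ∈ V, uinv l) * ∏ l ∈ W \ V, (uinv l - 1)) * D S χ U' V)
      - ((∏ l ∈ W, u l) * D S χ U' W
          + ∑ V ∈ W.powerset.erase W, ((∏ l ∈ V, u l) * ∏ l ∈ W \ V, (u l - 1)) * D S χ U' V) =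
      (2 * D S χ U' W - (∏ l ∈ W, uinv l) * D S χ U' W - (∏ l ∈ W, u l) * D S χ U' W)
      - ∑ V ∈ W.powerset.erase W, ((∏ l ∈ V, uinv l) * ∏ l ∈ W \ V, (uinv l - 1)) * D S χ U' V
      - ∑ V ∈ W.powerset.erase W, ((∏ l ∈ V, u l) * ∏ l ∈ W \ V, (u l - 1)) * D S χ U' V := by ring
  rw [e]
  exact Ideal.sub_mem _ (Ideal.sub_mem _ hmain H1) H2

end Main



section MainTerm

variable {ι : Type*} [Fintype ι] [DecidableEq ι]
variable {G : ι → Type*} [∀ i, CommGroup (G i)] [∀ i, Fintype (G i)] [∀ i, DecidableEq (G i)]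
variable {B : Type*} [CommRing B]
variable (S : DistSystem ι G B) (χ : Π i, G i →* Bˣ) (J : Ideal B)

/-- `Θ_U = Σ_{a ∈ slice U} x_U(a) · Π_{ℓ∈U} χ_ℓ(a_ℓ)` — the "character sum" of the level-`U` function. [folklore] -/
def Theta (U : Finset ι) : B := ∑ a ∈ slice U, S.x U a * ∏ l ∈ U, ((χ l (a l) : Bˣ) : B)

/-- `Θ_U = Σ_{W ⊆ U} D U W` (expand `χ = 1 + (χ − 1)`). [folklore] -/
theorem Theta_eq_sum_D (U : Finset ι) : Theta S χ U = ∑ W ∈ U.powerset, D S χ U W := by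
  unfold Theta D
  have : ∀ a ∈ slice U, S.x U a * ∏ l ∈ U, ((χ l (a l) : Bˣ) : B) =
      ∑ W ∈ U.powerset, S.x U a * ∏ l ∈ W, (((χ l (a l) : Bˣ) : B) - 1) := by
    intro a _
    have e : ∀ l ∈ U, ((χ l (a l) : Bˣ) : B) = (((χ l (a l) : Bˣ) : B) - 1) + 1 := fun l _ => by ring
    rw [Finset.prod_congr rfl e, Finset.prod_add, Finset.mul_sum]
    refine Finset.sum_congr rfl fun W _ => ?_
    rw [Finset.prod_const_one, mul_one]
  rw [Finset.sum_congr rfl this, Finset.sum_comm]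

variable (hχ : ∀ i (b : G i), ((χ i b : Bˣ) : B) - 1 ∈ J)
variable (L : Π i, G i → B) (y : B) (hy : y ∈ J)
variable (hL : ∀ i (b : G i), ((χ i b : Bˣ) : B) - 1 - L i b * y ∈ J ^ 2)

include hy hL in
/-- Main term: `D U U ≡ y^{|U|} · Σ_a x_U(a) Π_ℓ L_ℓ(a_ℓ) (mod J^{|U|+1})`. [folklore] -/
theorem D_self_sub_mem (U : Finset ι) :
    D S χ U U - y ^ U.card * ∑ a ∈ slice U, S.x U a * ∏ l ∈ U, L l (a l) ∈ J ^ (U.card + 1) := by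
  unfold D
  rw [Finset.mul_sum, ← Finset.sum_sub_distrib]
  refine sum_mem fun a _ => ?_
  have e : S.x U a * ∏ l ∈ U, (((χ l (a l) : Bˣ) : B) - 1) - y ^ U.card * (S.x U a * ∏ l ∈ U, L l (a l)) =
      S.x U a * (∏ l ∈ U, (((χ l (a l) : Bˣ) : B) - 1) - y ^ U.card * ∏ l ∈ U, L l (a l)) := by ring
  rw [e]
  exact Ideal.mul_mem_left _ _ (prod_sub_pow_mul_prod_mem J U _ _ y hy fun l _ => hL l (a l))

include hχ hy hL in
/-- THE LEADING-TERM LEMMA: `Θ_U ≡ y^{|U|} · Σ_a x_U(a)·Π_ℓ L_ℓ(a_ℓ) (mod J^{|U|+1})`. [folklore] -/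
theorem Theta_sub_mem (U : Finset ι) :
    Theta S χ U - y ^ U.card * ∑ a ∈ slice U, S.x U a * ∏ l ∈ U, L l (a l) ∈ J ^ (U.card + 1) := by
  rw [Theta_eq_sum_D, ← Finset.add_sum_erase _ _ (Finset.mem_powerset_self U)]
  have e : D S χ U U + ∑ W ∈ U.powerset.erase U, D S χ U W
      - y ^ U.card * ∑ a ∈ slice U, S.x U a * ∏ l ∈ U, L l (a l) =
      (D S χ U U - y ^ U.card * ∑ a ∈ slice U, S.x U a * ∏ l ∈ U, L l (a l))
      + ∑ W ∈ U.powerset.erase U, D S χ U W := by ring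
  rw [e]
  refine Ideal.add_mem _ (D_self_sub_mem S χ J L y hy hL U) (sum_mem fun W hW => ?_)
  obtain ⟨hWU, hWp⟩ := Finset.mem_erase.1 hW
  exact D_mem_pow_succ S χ J hχ U.card U W rfl
    (Finset.ssubset_iff_subset_ne.2 ⟨Finset.mem_powerset.1 hWp, hWU⟩)

end MainTerm

end Summit.BirchSwinnertonDyer.Rank1Residual.Supersingular.KuriharaTwist.Identity
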